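import Literature.Analysis.FluidPDE.LinearisedNSFourierForcedPicard
import HarnessLib

/-!
# The forced Picard iteration of the linearised Navier–Stokes equation with a source: convergence, the limit

Analysis/FluidPDE proof file, third of the files `LinearisedNSFourierForced*` (objects in
`LinearisedNSFourierForcedDefs`; the forced Duhamel map in `LinearisedNSFourierForcedPicard`),
the inhomogeneous twin of `LinearisedNSFourierIteration`. For data `(ν, T, U, G, a)` under
`PicardHypF` the forced Picard iterates `c₀ = 0`, `cₙ₊₁ = Φ_G(cₙ) = Φ(cₙ) + forcing` of the
mild linearised equation with source converge on the whole interval `[0, T]`: consecutive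
differences are differences of the HOMOGENEOUS map (`picardIterF_succ_sub`), so the contraction
`PicardHyp.exists_contraction` of `LinearisedNSFourierPicard` drives the iteration unchanged —
the source only shifts the first iterate `c₁ = e^{-νₖτ}a + forcing` (Leray 1934, §19, for
successive approximations; Lemarié-Rieusset 2016, §8.5, for the weighted sup-norms):

* `PicardHypF.iter_estimates`, `PicardHypF.iter_tendsto` — continuity of the iterates,
  geometric convergence with every polynomial decay uniformly in time;
* the limit `c = picardLimF`: continuous in time (`continuous_picardLimF`), every decay
  (`hasDecay_picardLimF`), the mild equation `c = Φ_G(c)` (`picardLimF_eq_picardMapF`) and the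
  datum `c(l, 0, k) = a(l, k)` (`picardLimF_zero`);
* structure read off the fixed-point equation: the limit is **Fourier-divergence free** when
  the datum is (`sum_intCast_mul_picardLimF`: both the projected symbol and the projected
  source are), and its **zero mode vanishes** when the datum and the source have vanishing
  zero modes and the drift is Fourier-divergence free (`picardLimF_zero_freq`) — `div w = 0`
  and `∫ w = 0` propagate from the datum for a mean-zero source (Constantin–Foias 1988, Ch. 14).

## References

* P. Constantin, C. Foias, *Navier–Stokes Equations*, Univ. Chicago Press 1988, Ch. 14, (14.3)–(14.4). [`ConstantinFoiasNSE1988`]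
* P. G. Lemarié-Rieusset, *The Navier–Stokes problem in the 21st century*, CRC 2016, §8.5.
* J. Leray, Acta Math. 63 (1934), §19. [`Leray1934`]
-/

noncomputable section

open MeasureTheory Real Set Filter Topology UnitAddTorus intervalIntegral

namespace Literature.Analysis.FluidPDE

namespace LinearisedNSFourier

open ScalarFourier
open CorrectorFourier (leraySym)
open FourierNS (HasDecay clamp)
open Literature.Analysis.FunctionSpaces.Torus (freqNormSq)

variable {d : Type*} [Fintype d] [DecidableEq d]
variable {ν T : ℝ} {U G : d → ℝ → (d → ℤ) → ℂ} {a : d → (d → ℤ) → ℂ}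

/-! ### The iteration: geometric convergence -/

section Iteration

/-- **The forced iteration estimates.** With `λ` from `PicardHyp.exists_contraction` (the
contraction of the HOMOGENEOUS map) and `D` an order-`K+1` constant of the first forced
iterate `c₁ = Φ_G(0)`, for every `n`: `cₙ` is continuous in time at each component and
frequency, `‖cₙ₊₁(l,t) - cₙ(l,t)‖ ≤ D 2^{-n} e^{λ clamp t} (1+‖·‖)^{-(K+1)}` and
`‖cₙ(l,t)‖ ≤ 2D(1 - 2^{-n}) e^{λT} (1+‖·‖)^{-(K+1)}` (induction on `n`; consecutive
differences are differences of the homogeneous map, `picardIterF_succ_sub`). [folklore] -/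
theorem PicardHypF.iter_estimates (h : PicardHypF ν T U G a) {K : ℕ} (hK : latOrder d ≤ K)
    {lam : ℝ} (hlam : 1 ≤ lam)
    (hcontr : ∀ (c₁ c₂ : d → ℝ → (d → ℤ) → ℂ) (X₁ X₂ D : ℝ),
      (∀ l m, Continuous fun t => c₁ l t m) → (∀ l m, Continuous fun t => c₂ l t m) →
      (∀ l t, HasDecay (latOrder d + 1) X₁ (c₁ l t)) → (∀ l t, HasDecay (latOrder d + 1) X₂ (c₂ l t)) →
      0 ≤ D →
      (∀ l t, HasDecay (K + 1) (D * Real.exp (lam * clamp T t)) (fun m => c₁ l t m - c₂ l t m)) →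
      ∀ l t, HasDecay (K + 1) (1 / 2 * D * Real.exp (lam * clamp T t))
        (fun k => picardMap ν T U a c₁ l t k - picardMap ν T U a c₂ l t k))
    {D : ℝ} (hD : 0 ≤ D) (hbase : ∀ l t, HasDecay (K + 1) D (picardMapF ν T U G a (fun _ _ _ => 0) l t))
    (n : ℕ) :
    (∀ l m, Continuous fun t => picardIterF ν T U G a n l t m) ∧
    (∀ l t, HasDecay (K + 1) (D * (1 / 2) ^ n * Real.exp (lam * clamp T t))
      (fun m => picardIterF ν T U G a (n + 1) l t m - picardIterF ν T U G a n l t m)) ∧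
    (∀ l t, HasDecay (K + 1) (2 * D * (1 - (1 / 2) ^ n) * Real.exp (lam * T))
      (picardIterF ν T U G a n l t)) := by
  have hlam0 : 0 ≤ lam := by linarith
  have hK1 : latOrder d + 1 ≤ K + 1 := by omega
  induction n with
  | zero =>
    refine ⟨fun l m => ?_, fun l t => ?_, fun l t => ?_⟩
    · simpa using continuous_const
    · intro m
      have h1 := hbase l t m
      simp only [picardIterF_succ, picardIterF_zero, sub_zero, pow_zero, mul_one]
      exact h1.trans (mul_le_mul_of_nonneg_right
        (le_mul_of_one_le_right hD (one_le_exp_clamp hlam0 t)) (by positivity))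
    · intro m
      simp
  | succ n ih =>
    obtain ⟨hcont, hdiff, hbound⟩ := ih
    -- (iii) at `n + 1`
    have hbound' : ∀ l t, HasDecay (K + 1) (2 * D * (1 - (1 / 2) ^ (n + 1)) * Real.exp (lam * T))
        (picardIterF ν T U G a (n + 1) l t) := by
      intro l t m
      have h1 := hbound l t m
      have h2 := hdiff l t m
      have hexp := exp_clamp_le (T := T) hlam0 h.hT.le t
      calc ‖picardIterF ν T U G a (n + 1) l t m‖ ≤ ‖picardIterF ν T U G a n l t m‖ +
            ‖picardIterF ν T U G a (n + 1) l t m - picardIterF ν T U G a n l t m‖ := norm_le_insert' _ _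
        _ ≤ 2 * D * (1 - (1 / 2) ^ n) * Real.exp (lam * T) * ((1 + ‖m‖) ^ (K + 1))⁻¹ +
            D * (1 / 2) ^ n * Real.exp (lam * clamp T t) * ((1 + ‖m‖) ^ (K + 1))⁻¹ :=
          add_le_add h1 h2
        _ ≤ 2 * D * (1 - (1 / 2) ^ n) * Real.exp (lam * T) * ((1 + ‖m‖) ^ (K + 1))⁻¹ +
            D * (1 / 2) ^ n * Real.exp (lam * T) * ((1 + ‖m‖) ^ (K + 1))⁻¹ := by gcongr
        _ = 2 * D * (1 - (1 / 2) ^ (n + 1)) * Real.exp (lam * T) * ((1 + ‖m‖) ^ (K + 1))⁻¹ := by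
          ring
    -- (i) at `n + 1`
    have hcont' : ∀ l m, Continuous fun t => picardIterF ν T U G a (n + 1) l t m := fun l m => by
      simp only [picardIterF_succ]
      exact h.continuous_picardMapF hcont (fun l t => (hbound l t).of_le hK1) l m
    -- (ii) at `n + 1`: the difference is a difference of the homogeneous map
    refine ⟨hcont', fun l t => ?_, hbound'⟩
    have key := hcontr (picardIterF ν T U G a (n + 1)) (picardIterF ν T U G a n) _ _
      (D * (1 / 2) ^ n) hcont' hcont (fun l t => (hbound' l t).of_le hK1)
      (fun l t => (hbound l t).of_le hK1) (by positivity) hdiff l t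
    have hfun : (fun m => picardIterF ν T U G a (n + 1 + 1) l t m - picardIterF ν T U G a (n + 1) l t m) =
        fun m => picardMap ν T U a (picardIterF ν T U G a (n + 1)) l t m -
          picardMap ν T U a (picardIterF ν T U G a n) l t m :=
      funext fun m => picardIterF_succ_sub ν T U G a n l t m
    rw [hfun]
    convert key using 2
    ring

/-- **Convergence of the forced Picard iteration with all estimates.** For every order
`K ≥ 2#d` there are `R ≥ 0` and the weight `λ ≥ 1` of `PicardHyp.exists_contraction` such
that all iterates are continuous in time, `‖cₙ(l,t)‖ ≤ R (1+‖·‖)^{-(K+1)}`, and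
`cₙ → c = picardLimF` with `‖cₙ(l,t) - c(l,t)‖ ≤ R 2^{-n} (1+‖·‖)^{-(K+1)}` uniformly in `t`
(geometric series; Mathlib `cauchySeq_of_le_geometric`, `dist_le_of_le_geometric_of_tendsto`). [folklore] -/
theorem PicardHypF.iter_tendsto (h : PicardHypF ν T U G a) {K : ℕ} (hK : latOrder d ≤ K) :
    ∃ R lam : ℝ, 0 ≤ R ∧ 1 ≤ lam ∧
      (∀ (c₁ c₂ : d → ℝ → (d → ℤ) → ℂ) (X₁ X₂ D : ℝ),
        (∀ l m, Continuous fun t => c₁ l t m) → (∀ l m, Continuous fun t => c₂ l t m) →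
        (∀ l t, HasDecay (latOrder d + 1) X₁ (c₁ l t)) → (∀ l t, HasDecay (latOrder d + 1) X₂ (c₂ l t)) →
        0 ≤ D →
        (∀ l t, HasDecay (K + 1) (D * Real.exp (lam * clamp T t)) (fun m => c₁ l t m - c₂ l t m)) →
        ∀ l t, HasDecay (K + 1) (1 / 2 * D * Real.exp (lam * clamp T t))
          (fun k => picardMap ν T U a c₁ l t k - picardMap ν T U a c₂ l t k)) ∧
      (∀ n l m, Continuous fun t => picardIterF ν T U G a n l t m) ∧
      (∀ n l t, HasDecay (K + 1) R (picardIterF ν T U G a n l t)) ∧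
      (∀ l t m, Tendsto (fun n => picardIterF ν T U G a n l t m) atTop (𝓝 (picardLimF ν T U G a l t m))) ∧
      (∀ n l t, HasDecay (K + 1) (R * (1 / 2) ^ n)
        (fun m => picardIterF ν T U G a n l t m - picardLimF ν T U G a l t m)) := by
  obtain ⟨lam, hlam, hcontr⟩ := h.toPicardHyp.exists_contraction hK
  obtain ⟨A₀, hA₀, ha⟩ := h.toPicardHyp.decayA_nonneg (K + 1)
  obtain ⟨B, hB0, hB⟩ := h.decayG_nonneg (K + 1)
  set D := A₀ + T * (2 * Fintype.card d * B) with hDdef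
  have hD : 0 ≤ D := by have := h.hT.le; positivity
  have hbase : ∀ l t, HasDecay (K + 1) D (picardMapF ν T U G a (fun _ _ _ => 0) l t) :=
    h.hasDecay_picardMapF_zero ha hB0 hB
  have hest := h.iter_estimates hK hlam hcontr hD hbase
  have hlam0 : 0 ≤ lam := by linarith
  set R := 2 * D * Real.exp (lam * T) with hR
  have hR0 : 0 ≤ R := by positivity
  -- the geometric bound on consecutive differences, uniformly in `t`
  have hstep : ∀ l t m n, dist (picardIterF ν T U G a n l t m) (picardIterF ν T U G a (n + 1) l t m) ≤
      D * Real.exp (lam * T) * ((1 + ‖m‖) ^ (K + 1))⁻¹ * (1 / 2) ^ n := by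
    intro l t m n
    rw [dist_eq_norm, norm_sub_rev]
    have h1 := (hest n).2.1 l t m
    have hexp := exp_clamp_le (T := T) hlam0 h.hT.le t
    calc _ ≤ D * (1 / 2) ^ n * Real.exp (lam * clamp T t) * ((1 + ‖m‖) ^ (K + 1))⁻¹ := h1
      _ ≤ D * (1 / 2) ^ n * Real.exp (lam * T) * ((1 + ‖m‖) ^ (K + 1))⁻¹ := by gcongr
      _ = _ := by ring
  have hcauchy : ∀ l t m, CauchySeq fun n => picardIterF ν T U G a n l t m := fun l t m =>
    cauchySeq_of_le_geometric (1 / 2) _ (by norm_num) (hstep l t m)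
  have htend : ∀ l t m, Tendsto (fun n => picardIterF ν T U G a n l t m) atTop
      (𝓝 (picardLimF ν T U G a l t m)) := fun l t m => (hcauchy l t m).tendsto_limUnder
  have herr : ∀ n l t m, ‖picardIterF ν T U G a n l t m - picardLimF ν T U G a l t m‖ ≤
      R * (1 / 2) ^ n * ((1 + ‖m‖) ^ (K + 1))⁻¹ := by
    intro n l t m
    have h1 := dist_le_of_le_geometric_of_tendsto (1 / 2) _ (by norm_num) (hstep l t m) (htend l t m) n
    rw [dist_eq_norm] at h1
    refine h1.trans_eq ?_
    simp only [hR]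
    ring
  refine ⟨R, lam, hR0, hlam, hcontr, fun n => (hest n).1, fun n l t m => ?_, htend,
    fun n l t m => herr n l t m⟩
  have h1 := (hest n).2.2 l t m
  refine h1.trans (mul_le_mul_of_nonneg_right ?_ (by positivity))
  simp only [hR]
  have : (0:ℝ) ≤ (1 / 2) ^ n := by positivity
  nlinarith [Real.exp_pos (lam * T)]

/-- The forced Picard limit is continuous in time at each component and frequency (uniform
limit of continuous functions, Mathlib `TendstoUniformly.continuous`). [folklore] -/
theorem PicardHypF.continuous_picardLimF (h : PicardHypF ν T U G a) (l : d) (m : d → ℤ) :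
    Continuous fun t => picardLimF ν T U G a l t m := by
  obtain ⟨R, lam, hR0, -, -, hcont, -, -, herr⟩ := h.iter_tendsto le_rfl
  have hunif : TendstoUniformly (fun n t => picardIterF ν T U G a n l t m)
      (fun t => picardLimF ν T U G a l t m) atTop := by
    refine Metric.tendstoUniformly_iff.2 fun ε hε => ?_
    have hgeo : Tendsto (fun n : ℕ => R * (1 / 2 : ℝ) ^ n) atTop (𝓝 0) := by
      have := tendsto_pow_atTop_nhds_zero_of_lt_one (r := (1 / 2 : ℝ)) (by norm_num) (by norm_num)
      simpa using this.const_mul R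
    filter_upwards [(tendsto_order.1 hgeo).2 ε hε] with n hn t
    rw [dist_comm, dist_eq_norm]
    have h1 := herr n l t m
    have hw : ((1 + ‖m‖) ^ (latOrder d + 1))⁻¹ ≤ 1 := FourierNS.inv_one_add_norm_pow_le_one m _
    calc _ ≤ R * (1 / 2) ^ n * ((1 + ‖m‖) ^ (latOrder d + 1))⁻¹ := h1
      _ ≤ R * (1 / 2) ^ n * 1 := by gcongr
      _ < ε := by rw [mul_one]; exact hn
  exact hunif.continuous (Frequently.of_forall fun n => hcont n l m)

/-- **Every polynomial decay of the forced Picard limit**, uniformly in time and component. [folklore] -/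
theorem PicardHypF.hasDecay_picardLimF (h : PicardHypF ν T U G a) (K : ℕ) :
    ∃ C : ℝ, 0 ≤ C ∧ ∀ l t, HasDecay K C (picardLimF ν T U G a l t) := by
  obtain ⟨R, lam, hR0, -, -, -, -, -, herr⟩ := h.iter_tendsto (le_max_left (latOrder d) K)
  refine ⟨R, hR0, fun l t m => ?_⟩
  have h1 := herr 0 l t m
  simp only [picardIterF_zero, zero_sub, norm_neg, pow_zero, mul_one] at h1
  exact h1.trans (mul_le_mul_of_nonneg_left
    (FourierNS.inv_one_add_norm_pow_anti m (by omega)) hR0)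

/-- **The forced Picard limit is a fixed point of the forced Duhamel map**: `c = Φ_G(c)`,
i.e. the mild equation
`c(l,t,k) = e^{-νₖτ} a(l,k) - ∫₀^τ e^{-νₖ(τ-s)} (P linSym)(U(s), c(s))(l,k) ds
  + ∫₀^τ e^{-νₖ(τ-s)} (P G(s))ₗ(k) ds`, `τ = clamp T t`
(`Φ_G(c) - cₙ₊₁ = Φ(c) - Φ(cₙ)` is controlled by the homogeneous contraction). [folklore] -/
theorem PicardHypF.picardLimF_eq_picardMapF (h : PicardHypF ν T U G a) (l : d) (t : ℝ) (k : d → ℤ) :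
    picardLimF ν T U G a l t k = picardMapF ν T U G a (picardLimF ν T U G a) l t k := by
  obtain ⟨R, lam, hR0, hlam, hcontr, hcont, hdec, -, herr⟩ := h.iter_tendsto le_rfl
  have hlam0 : 0 ≤ lam := by linarith
  set c := picardLimF ν T U G a with hc
  have hcc : ∀ l m, Continuous fun t => c l t m := h.continuous_picardLimF
  have hcd : ∀ l t, HasDecay (latOrder d + 1) R (c l t) := fun l t m => by
    have h1 := herr 0 l t m
    simpa [picardIterF_zero] using h1
  -- `‖Φ_G c - c‖ ≤ ½ R 2^{-n} e^{λ clamp t} w + R 2^{-(n+1)} w` for every `n`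
  have hbound : ∀ n : ℕ, ‖picardMapF ν T U G a c l t k - c l t k‖ ≤
      (1 / 2 * (R * (1 / 2) ^ n) * Real.exp (lam * clamp T t) + R * (1 / 2) ^ (n + 1)) *
        ((1 + ‖k‖) ^ (latOrder d + 1))⁻¹ := by
    intro n
    have hdiff : ∀ l t, HasDecay (latOrder d + 1) (R * (1 / 2) ^ n * Real.exp (lam * clamp T t))
        (fun m => c l t m - picardIterF ν T U G a n l t m) := by
      intro l t m
      have h1 := herr n l t m
      rw [norm_sub_rev] at h1
      exact h1.trans (mul_le_mul_of_nonneg_right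
        (le_mul_of_one_le_right (by positivity) (one_le_exp_clamp hlam0 t)) (by positivity))
    have key := hcontr c (picardIterF ν T U G a n) R R (R * (1 / 2) ^ n) hcc (hcont n) hcd
      (fun l t => hdec n l t) (by positivity) hdiff l t k
    have hsub : picardMapF ν T U G a c l t k - picardIterF ν T U G a (n + 1) l t k =
        picardMap ν T U a c l t k - picardMap ν T U a (picardIterF ν T U G a n) l t k := by
      rw [picardIterF_succ, picardMapF_sub]
    have h2 := herr (n + 1) l t k
    calc ‖picardMapF ν T U G a c l t k - c l t k‖
        ≤ ‖picardMapF ν T U G a c l t k - picardIterF ν T U G a (n + 1) l t k‖ +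
          ‖picardIterF ν T U G a (n + 1) l t k - c l t k‖ := norm_sub_le_norm_sub_add_norm_sub _ _ _
      _ ≤ 1 / 2 * (R * (1 / 2) ^ n) * Real.exp (lam * clamp T t) * ((1 + ‖k‖) ^ (latOrder d + 1))⁻¹ +
          R * (1 / 2) ^ (n + 1) * ((1 + ‖k‖) ^ (latOrder d + 1))⁻¹ := by
          rw [hsub]; exact add_le_add key h2
      _ = _ := by ring
  have hlim : Tendsto (fun n : ℕ => (1 / 2 * (R * (1 / 2) ^ n) * Real.exp (lam * clamp T t) +
      R * (1 / 2) ^ (n + 1)) * ((1 + ‖k‖) ^ (latOrder d + 1))⁻¹) atTop (𝓝 0) := by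
    have hg := tendsto_pow_atTop_nhds_zero_of_lt_one (r := (1 / 2 : ℝ)) (by norm_num) (by norm_num)
    have h1 : Tendsto (fun n : ℕ => (1 / 2 * (R * (1 / 2 : ℝ) ^ n) * Real.exp (lam * clamp T t) +
        R * (1 / 2) ^ (n + 1))) atTop (𝓝 0) := by
      have e1 := (hg.const_mul R).const_mul (1 / 2 : ℝ)
      have e2 := e1.mul_const (Real.exp (lam * clamp T t))
      have e3 := (hg.comp (tendsto_add_atTop_nat 1)).const_mul R
      simp only [mul_zero, zero_mul] at e2 e3
      have := e2.add e3
      simp only [add_zero] at this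
      refine this.congr fun n => ?_
      simp only [Function.comp_apply]
    simpa using h1.mul_const (((1 + ‖k‖) ^ (latOrder d + 1))⁻¹)
  have h0 : ‖picardMapF ν T U G a c l t k - c l t k‖ ≤ 0 :=
    ge_of_tendsto' hlim fun n => hbound n
  have := norm_le_zero_iff.1 h0
  rw [sub_eq_zero] at this
  exact this.symm

/-- **The forced Picard limit attains the datum**: `c(l, 0, k) = a(l, k)`. [folklore] -/
theorem PicardHypF.picardLimF_zero (h : PicardHypF ν T U G a) (l : d) (k : d → ℤ) :
    picardLimF ν T U G a l 0 k = a l k := by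
  rw [h.picardLimF_eq_picardMapF l 0 k, picardMapF_zero_time h.hT.le]

end Iteration

/-! ### Divergence freedom and the zero mode, from the fixed-point equation -/

section Structure

/-- **The forced Picard limit is Fourier-divergence free** when the datum is:
`∑ₗ kₗ c(l, t, k) = 0` (`div w(t) = 0` propagates from `div w₀ = 0`; read off `c = Φ_G(c)`,
both Duhamel integrands being projected families). [folklore] -/
theorem PicardHypF.sum_intCast_mul_picardLimF (h : PicardHypF ν T U G a)
    (hadiv : ∀ k, ∑ l, (k l : ℂ) * a l k = 0) (t : ℝ) (k : d → ℤ) :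
    ∑ l, (k l : ℂ) * picardLimF ν T U G a l t k = 0 := by
  obtain ⟨R, -, hR⟩ := h.hasDecay_picardLimF (latOrder d + 1)
  have hcc : ∀ l m, Continuous fun t => picardLimF ν T U G a l t m := h.continuous_picardLimF
  have hfix : ∀ l, picardLimF ν T U G a l t k =
      picardMapF ν T U G a (picardLimF ν T U G a) l t k := fun l => h.picardLimF_eq_picardMapF l t k
  simp_rw [hfix]
  exact h.sum_intCast_mul_picardMapF hadiv hcc hR t k

/-- **The forced Picard limit has vanishing zero mode** (zero spatial mean of the synthesized
velocity): if `a(l, 0) = 0`, the datum and the drift coefficients are Fourier-divergence free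
and the source has vanishing zero mode `Gⱼ(s)(0) = 0` (mean-zero source slices), then
`c(l, t, 0) = 0` — at the zero frequency the heat factor multiplies `a(l, 0) = 0`, the
projected symbol vanishes (`linProjSym_zero_freq`, with the divergence freedom of `c` itself)
and so does the forcing term (`forcing_zero_freq`). [folklore] -/
theorem PicardHypF.picardLimF_zero_freq (h : PicardHypF ν T U G a) (ha0 : ∀ l, a l 0 = 0)
    (hadiv : ∀ k, ∑ l, (k l : ℂ) * a l k = 0) (hUdiv : ∀ t m, ∑ j, (m j : ℂ) * U j t m = 0)
    (hG0 : ∀ j s, G j s 0 = 0) (l : d) (t : ℝ) : picardLimF ν T U G a l t 0 = 0 := by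
  obtain ⟨R, -, hR⟩ := h.hasDecay_picardLimF (latOrder d + 1)
  obtain ⟨A, hA⟩ := h.decayU (latOrder d + 1)
  have hcdiv : ∀ s m, ∑ j, (m j : ℂ) * picardLimF ν T U G a j s m = 0 :=
    h.sum_intCast_mul_picardLimF hadiv
  rw [h.picardLimF_eq_picardMapF l t 0, picardMapF_apply, forcing_zero_freq hG0, add_zero, picardMap]
  have hzero : ∀ s, linProjSym (fun j => U j s) (fun j => picardLimF ν T U G a j s) l 0 = 0 := fun s =>
    linProjSym_zero_freq (fun j => hA j s) (fun j => hR j s) (hUdiv s) (hcdiv s) l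
  simp_rw [hzero, mul_zero, intervalIntegral.integral_zero, sub_zero, ha0 l, mul_zero]

end Structure

end LinearisedNSFourier

end Literature.Analysis.FluidPDE

end
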